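import Mathlib
import Literature.AlgebraicGeometry.Resolution.LipmanValuativeQuadraticSequence
import Literature.AlgebraicGeometry.Resolution.LocalUniformization
import Literature.AlgebraicGeometry.Resolution.RegularLocusPerfectField
import Summits.ResolutionOfSingularities.ResolutionOfSingularities.Theorems.SyzygyFlatteningRankOneTerminationSurfaceCase
import Summits.ResolutionOfSingularities.ResolutionOfSingularities.Theorems.AbhyankarShadowsSemivaluationShadowsHenselPresentation
import Summits.ResolutionOfSingularities.ResolutionOfSingularities.Theorems.AbhyankarShadowsSemivaluationShadowsHenselOverRuledShadowsRankOne
import HarnessLib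

/-!
# Surface bridge: Lipman's theorem ⇒ a Hensel-over-ruled presentation of the valued surface
(crux `SemivaluationShadows`, line `birth`; registered sub-goal `exists_henselPresentation_of_lipman`)

Registered sub-goal `exists_henselPresentation_of_lipman` of the crux
`stmt-ResolutionOfSingularities-16757` (`Theses.AbhyankarShadows.SemivaluationShadows`, the
existence half of Teissier's semivaluation conjecture), line `birth`. This is the SURFACE BRIDGE
of the line: for a function field `K/k` of transcendence degree `2` over an algebraically closed
field `k` and a valuation ring `O ⊇ k` of `K` all of whose residues are constants, Lipman's
theorem puts the centre of `O` at a REGULAR point of some model, whence étale coordinates at the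
centre, whence (landed file `…SemivaluationShadowsHenselPresentation.lean`,
`exists_henselPresentation_of_coordinates`) the Hensel-over-ruled presentation of `(K, O)`
consumed by the registered stub `stub_henselOverRuledShadowsRankOne` of the line. The result is
CONDITIONAL on the named fact `Lipman1978ValuativeQuadraticSequence` (Lipman 1978, Theorem
p. 151 = Liu 2002, Thm. 8.3.44, valuative corollary), taken as a hypothesis.

* `valuation_map_eq_one_of_isUnit` — units of an algebra mapped into `O` have value `1`.
* `exists_etaleCoordinates_of_isRegularLocalRing` — **étale coordinates at a regular centre**:
  a regular local `k`-algebra `A ⊆ O` essentially of finite type with `Frac A = K`,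
  `tr.deg_k K = 2`, `k` perfect, yields `u₀, u₁, η ∈ O`, `h` monic over `k[u₀, u₁]` with
  `u₀, u₁` algebraically independent, `h(η) = 0`, `ν(h'(η)) = 1`, `K = k(u₀, u₁, η)` (Mathlib's
  local structure theorem `Algebra.IsSmoothAt.exists_isStandardEtale_mvPolynomial` applied to the
  smooth — because regular over a perfect field, tree `RegularLocusPerfectField.lean` — centre).
* `exists_henselPresentation_of_lipman` — the registered statement: an affine model `A ⊆ O`
  (`exists_affineModel`); by the landed surface case of the syzygy-flattening route
  (`SyzygyFlattening.stub_surfaceCase`, whose hypothesis is VERBATIM the Lipman fact at universe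
  `0`, and whose tower from a surface IS Lipman's sequence of normalised quadratic transforms along
  `O`) some stage `tower O A m` of the tower is a regular local ring; it lies in `O`, is
  essentially of finite type with fraction field `K` (`SyzygyFlattening.tower_toSubring_le`,
  `essFiniteType_tower`, `isFractionRing_tower`); then the two previous items.

## Sources

* J. Lipman, *Desingularization of two-dimensional schemes*, Ann. of Math. 107 (1978) 151–207,
  Theorem p. 151; Q. Liu, *Algebraic Geometry and Arithmetic Curves*, OUP 2002, Thm. 8.3.44
  (the named fact `Lipman1978ValuativeQuadraticSequence`, hypothesis here).
* The Stacks Project, Tags 00TV (regular + separable residue field ⇒ smooth), 054L / 00UE (local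
  structure of smooth / étale algebras) — through Mathlib and `RegularLocusPerfectField.lean`.
* Everything else is [folklore] bookkeeping inside the function field.
-/

-- single-problem summit: the doubled namespace component `ResolutionOfSingularities` is forced
set_option linter.dupNamespace false

noncomputable section

open Polynomial IsLocalRing Literature.AlgebraicGeometry.Resolution
open scoped IntermediateField.algebraAdjoinAdjoin

namespace Summit.ResolutionOfSingularities.ResolutionOfSingularities.Theorems

/-- Units of a `k`-algebra `A` mapped into a valuation ring `O` are `O`-units: their value is
`1`. [folklore] -/
theorem valuation_map_eq_one_of_isUnit {k K A : Type*} [Field k] [Field K] [Algebra k K]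
    [CommRing A] [Algebra k A] (O : ValuationSubring K) (ι : A →ₐ[k] K) (hιO : ∀ a : A, ι a ∈ O)
    {a : A} (ha : IsUnit a) : O.valuation (ι a) = 1 := by
  obtain ⟨w, hw⟩ := ha.exists_right_inv
  have h1 : O.valuation (ι a) ≤ 1 := (O.valuation_le_one_iff _).mpr (hιO a)
  have h2 : O.valuation (ι w) ≤ 1 := (O.valuation_le_one_iff _).mpr (hιO w)
  have h3 : O.valuation (ι a) * O.valuation (ι w) = 1 := by
    rw [← map_mul, ← map_mul, hw, map_one, map_one]
  refine le_antisymm h1 ?_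
  calc (1 : _) = O.valuation (ι a) * O.valuation (ι w) := h3.symm
    _ ≤ O.valuation (ι a) * 1 := mul_le_mul_right h2 _
    _ = O.valuation (ι a) := mul_one _

/-- **Étale coordinates at a regular centre** (Mathlib's local structure theorem for smooth
algebras, Stacks 054L/00UE, read inside the function field). Let `k` be a perfect field, `K/k` of
transcendence degree `2`, `O` a valuation ring of `K`, and `A` a REGULAR local `k`-algebra
essentially of finite type, embedded into `O` by `ι` with `K = Frac ι(A)`. Then there are
`u₀, u₁, η ∈ O` and a monic `h ∈ K[X]` with coefficients in `k[u₀, u₁]` such that `u₀, u₁` are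
algebraically independent over `k`, `h(η) = 0`, `h'(η)` is an `O`-unit and `K = k(u₀, u₁, η)`.
Proof: `A = C_𝔮` for a finitely generated `C` (`Algebra.EssFiniteType`); `C_𝔮` regular over the
perfect `k` ⇒ `C` smooth at `𝔮` (`isSmoothAt_iff_isRegularLocalRing_of_perfectField`, Stacks
00TV) ⇒ some `C_f`, `f ∉ 𝔮`, is standard étale over `k[X₁, …, X_n]`
(`Algebra.IsSmoothAt.exists_isStandardEtale_mvPolynomial`), i.e. `C_f ≅ (k[X][T]/(f₀))_{g₀}` with
`f₀` monic and `f₀'` a unit; map `C_f → A → K` (`f` is a unit of `A`): the images `uᵢ` of the `Xᵢ`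
are algebraically independent (`k[X] → C_f` is injective by flatness, `C_f → A` because `A` is a
domain), `η` = the image of `T`, `h = f₀`; every element of `C_f` is
`p(T)/g₀(T)^m`, so `k(u, η) ⊇ ι(C)`, hence `⊇ ι(A)` and `= K`; `η` is integral over `k[u]`, so
`u` is a transcendence basis and `n = tr.deg_k K = 2`. [cite: StacksProject, Tag 054L] -/
theorem exists_etaleCoordinates_of_isRegularLocalRing {k K A : Type} [Field k] [Field K]
    [Algebra k K] [PerfectField k] [CommRing A] [Algebra k A] [Algebra.EssFiniteType k A]
    [IsRegularLocalRing A] (O : ValuationSubring K) (htr : Algebra.trdeg k K = 2)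
    (ι : A →ₐ[k] K) (hι : Function.Injective ι) (hιO : ∀ a : A, ι a ∈ O)
    (hfrac : ∀ z : K, ∃ a b : A, z = ι a / ι b) :
    ∃ (u₀ u₁ η : K) (h : K[X]), AlgebraicIndependent k ![u₀, u₁] ∧ u₀ ∈ O ∧ u₁ ∈ O ∧ η ∈ O ∧
      (∀ i : ℕ, h.coeff i ∈ Algebra.adjoin k ({u₀, u₁} : Set K)) ∧ h.Monic ∧ aeval η h = 0 ∧
      O.valuation (aeval η (derivative h)) = 1 ∧
      IntermediateField.adjoin k ({u₀, u₁, η} : Set K) = ⊤ := by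
  classical
  /- 1. `A = C_q` for the finitely generated subalgebra `C` of which `A` is a localisation -/
  let C : Subalgebra k A := Algebra.EssFiniteType.subalgebra k A
  let M : Submonoid C := (IsUnit.submonoid A).comap (algebraMap C A)
  haveI hM : IsLocalization M A := Algebra.EssFiniteType.isLocalization k A
  let q : Ideal C := (maximalIdeal A).comap (algebraMap C A)
  haveI hq : q.IsPrime := Ideal.comap_isPrime _ _
  have hMq : M = q.primeCompl := by
    ext b
    simp only [M, q, Submonoid.mem_comap, IsUnit.mem_submonoid_iff, Ideal.mem_primeCompl_iff,
      Ideal.mem_comap, mem_maximalIdeal, mem_nonunits_iff, not_not]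
  haveI : IsLocalization q.primeCompl A := by rw [← hMq]; exact hM
  let e : Localization.AtPrime q ≃ₐ[C] A :=
    IsLocalization.algEquiv q.primeCompl (Localization.AtPrime q) A
  haveI : IsRegularLocalRing (Localization.AtPrime q) :=
    IsRegularLocalRing.of_ringEquiv e.toRingEquiv.symm
  /- 2. `C` is smooth at `q` (perfect ground field), hence standard étale over a polynomial
    ring on a neighbourhood `C_f` of `q` -/
  haveI hsm : Algebra.IsSmoothAt k q :=
    (isSmoothAt_iff_isRegularLocalRing_of_perfectField k C q).mpr inferInstance
  haveI : Algebra.FinitePresentation k C :=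
    (Algebra.FinitePresentation.of_finiteType (R := k) (A := C)).mp inferInstance
  obtain ⟨f, hfq, n, algInst, hst, hstd⟩ :=
    Algebra.IsSmoothAt.exists_isStandardEtale_mvPolynomial (R := k) (p := q)
  let R := MvPolynomial (Fin n) k
  let Cf := Localization.Away f
  letI : Algebra R Cf := algInst
  letI : SMul R Cf := Algebra.toSMul
  letI : Module R Cf := Algebra.toModule
  haveI : IsScalarTower k R Cf := hst
  haveI : Algebra.IsStandardEtale R Cf := hstd
  haveI hflat : Module.Flat R Cf := inferInstance
  let P : StandardEtalePresentation R Cf :=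
    (Algebra.IsStandardEtale.nonempty_standardEtalePresentation (R := R) (S := Cf)).some
  /- 3. `C_f → A → K` -/
  have hfu : IsUnit (C.val f) := by
    by_contra hf
    exact hfq (Ideal.mem_comap.mpr ((mem_maximalIdeal _).mpr (mem_nonunits_iff.mpr hf)))
  let φA : Cf →ₐ[k] A := IsLocalization.Away.liftAlgHom f (f := C.val) hfu
  have hφA : ∀ c : C, φA (algebraMap C Cf c) = (c : A) := fun c =>
    IsLocalization.Away.lift_eq f hfu c
  let φ : Cf →ₐ[k] K := ι.comp φA
  have hφO : ∀ z : Cf, φ z ∈ O := fun z => hιO (φA z)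
  have hφunit : ∀ z : Cf, IsUnit z → O.valuation (φ z) = 1 := fun z hz =>
    valuation_map_eq_one_of_isUnit O ι hιO (hz.map φA)
  have hφAinj : Function.Injective φA := by
    rw [injective_iff_map_eq_zero]
    intro z hz
    obtain ⟨c, s, rfl⟩ := IsLocalization.exists_mk'_eq (Submonoid.powers f) z
    have h1 : (c : A) = 0 := by
      rw [← hφA c, ← IsLocalization.mk'_spec Cf c s, map_mul, hz, zero_mul]
    have h2 : c = 0 := Subtype.ext h1
    rw [h2, IsLocalization.mk'_zero]
  have hφinj : Function.Injective φ := hι.comp hφAinj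
  haveI : Nontrivial Cf := φA.toRingHom.domain_nontrivial
  have hinjR : Function.Injective (algebraMap R Cf) := by
    intro a b hab
    by_contra hne
    have hreg : IsSMulRegular Cf (a - b) :=
      hflat.isSMulRegular_of_nonZeroDivisors
        (mem_nonZeroDivisors_of_ne_zero (sub_ne_zero.mpr hne))
    have h1 : (a - b) • (1 : Cf) = (a - b) • (0 : Cf) := by
      rw [Algebra.smul_def, Algebra.smul_def, mul_one, mul_zero, map_sub, hab, sub_self]
    exact one_ne_zero (hreg h1)
  /- 4. the coordinates `u`, the root `η` and the polynomial `h` in `K` -/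
  let θ : R →+* K := (φ : Cf →+* K).comp (algebraMap R Cf)
  let u : Fin n → K := fun i => θ (MvPolynomial.X i)
  let η : K := φ P.x
  have hθ : ∀ r : R, θ r = MvPolynomial.aeval u r := by
    intro r
    have hext := MvPolynomial.algHom_ext (f := φ.comp (IsScalarTower.toAlgHom k R Cf))
      (g := MvPolynomial.aeval u) (fun i => by rw [MvPolynomial.aeval_X]; rfl)
    exact DFunLike.congr_fun hext r
  have hφeval : ∀ p : R[X], φ (aeval P.x p) = (p.map θ).eval η := by
    intro p
    rw [Polynomial.eval_map, Polynomial.aeval_def]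
    exact Polynomial.hom_eval₂ p (algebraMap R Cf) (φ : Cf →+* K) P.x
  let h : K[X] := P.f.map θ
  have hmon : h.Monic := P.monic_f.map θ
  have hroot : aeval η h = 0 := by
    rw [Polynomial.coe_aeval_eq_eval, ← hφeval, P.hasMap.1, map_zero]
  have hder : O.valuation (aeval η (derivative h)) = 1 := by
    rw [Polynomial.coe_aeval_eq_eval, Polynomial.derivative_map, ← hφeval]
    exact hφunit _ P.hasMap.isUnit_derivative_f
  have hcoef : ∀ i : ℕ, h.coeff i ∈ Algebra.adjoin k (Set.range u) := by
    intro i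
    rw [Polynomial.coeff_map, hθ, Algebra.adjoin_range_eq_range_aeval]
    exact (AlgHom.mem_range _).mpr ⟨_, rfl⟩
  have huO : ∀ i, u i ∈ O := fun i => hφO _
  have hηO : η ∈ O := hφO _
  have hind : AlgebraicIndependent k u := by
    rw [algebraicIndependent_iff_injective_aeval]
    intro a b hab
    have h1 : θ a = θ b := by rw [hθ, hθ]; exact hab
    exact hinjR (hφinj h1)
  /- 5. generation: `k(u, η) = K` -/
  let F : IntermediateField k K := IntermediateField.adjoin k (insert η (Set.range u))
  have hηF : η ∈ F := IntermediateField.subset_adjoin k _ (Set.mem_insert _ _)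
  have huF : ∀ i, u i ∈ F := fun i =>
    IntermediateField.subset_adjoin k _ (Set.mem_insert_of_mem _ ⟨i, rfl⟩)
  have hθF : ∀ r : R, θ r ∈ F := by
    intro r
    have hle : Algebra.adjoin k (Set.range u) ≤ F.toSubalgebra :=
      Algebra.adjoin_le (by rintro _ ⟨i, rfl⟩; exact huF i)
    refine hle ?_
    rw [hθ, Algebra.adjoin_range_eq_range_aeval]
    exact (AlgHom.mem_range _).mpr ⟨r, rfl⟩
  have hevalF : ∀ p : R[X], (p.map θ).eval η ∈ F := by
    intro p
    rw [Polynomial.eval_map, Polynomial.eval₂_eq_sum_range]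
    exact sum_mem fun i _ => mul_mem (hθF _) (pow_mem hηF _)
  have hφF : ∀ z : Cf, φ z ∈ F := by
    intro z
    obtain ⟨p, m, hp⟩ := P.exists_mul_aeval_x_g_pow_eq_aeval_x z
    have hg1 := hφunit _ P.hasMap.2
    have hg : φ (aeval P.x P.g) ≠ 0 := by
      intro h0
      rw [h0, map_zero] at hg1
      exact zero_ne_one hg1
    have hgF : φ (aeval P.x P.g) ∈ F := by rw [hφeval]; exact hevalF _
    have hz : φ z = φ (aeval P.x p) * (φ (aeval P.x P.g) ^ m)⁻¹ := by
      rw [eq_mul_inv_iff_mul_eq₀ (pow_ne_zero _ hg), ← map_pow, ← map_mul, hp]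
    rw [hz]
    exact mul_mem (by rw [hφeval]; exact hevalF p) (inv_mem (pow_mem hgF m))
  have hCF : ∀ c : C, ι (c : A) ∈ F := fun c => by
    rw [← hφA c]
    exact hφF _
  have hAF : ∀ b : A, ι b ∈ F := by
    intro b
    obtain ⟨c, s, rfl⟩ := IsLocalization.exists_mk'_eq M b
    have hs : IsUnit ((s : C) : A) := s.2
    have hsK : ι ((s : C) : A) ≠ 0 := (hs.map ι).ne_zero
    have hspec : ι (IsLocalization.mk' A c s) * ι ((s : C) : A) = ι (c : A) := by
      rw [← map_mul]
      exact congrArg ι (IsLocalization.mk'_spec A c s)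
    rw [eq_div_of_mul_eq hsK hspec]
    exact div_mem (hCF c) (hCF s)
  have hF : F = ⊤ := by
    rw [eq_top_iff]
    intro z _
    obtain ⟨a, b, rfl⟩ := hfrac z
    exact div_mem (hAF a) (hAF b)
  /- 6. `n = 2`: `u` is a transcendence basis of `K/k` -/
  have hn : n = 2 := by
    have hηint : IsIntegral (Algebra.adjoin k (Set.range u)) η := by
      let θD : R →ₐ[k] Algebra.adjoin k (Set.range u) :=
        MvPolynomial.aeval fun i =>
          (⟨u i, Algebra.subset_adjoin ⟨i, rfl⟩⟩ : Algebra.adjoin k (Set.range u))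
      have hθD : ∀ r : R, ((θD r : Algebra.adjoin k (Set.range u)) : K) = θ r := by
        intro r
        rw [hθ]
        have hext := MvPolynomial.algHom_ext
          (f := (Algebra.adjoin k (Set.range u)).val.comp θD) (g := MvPolynomial.aeval u)
          (fun i => by simp [θD])
        exact DFunLike.congr_fun hext r
      refine ⟨P.f.map θD.toRingHom, P.monic_f.map _, ?_⟩
      have hcomp : (algebraMap (Algebra.adjoin k (Set.range u)) K).comp θD.toRingHom = θ :=
        RingHom.ext hθD
      rw [Polynomial.eval₂_map, hcomp, ← Polynomial.eval_map, ← hφeval, P.hasMap.1, map_zero]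
    set L : IntermediateField k K := IntermediateField.adjoin k (Set.range u) with hL
    have hηintL : IsIntegral L η := hηint.tower_top
    have hLtop : IntermediateField.adjoin L ({η} : Set K) = ⊤ := by
      apply IntermediateField.restrictScalars_injective k
      rw [IntermediateField.restrictScalars_top, hL, IntermediateField.adjoin_adjoin_left,
        Set.union_singleton]
      exact hF
    have halgL : Algebra.IsAlgebraic L K := by
      haveI h1 : Algebra.IsAlgebraic L (IntermediateField.adjoin L ({η} : Set K)) :=
        IntermediateField.isAlgebraic_adjoin_simple hηintL
      exact ((IntermediateField.equivOfEq hLtop).trans IntermediateField.topEquiv).isAlgebraic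
    have halgD : Algebra.IsAlgebraic (Algebra.adjoin k (Set.range u)) K :=
      IntermediateField.isAlgebraic_adjoin_iff_top.mp halgL
    have hTB : IsTranscendenceBasis k u := hind.isTranscendenceBasis_iff_isAlgebraic.mpr halgD
    have hcard := hTB.cardinalMk_eq_trdeg
    rw [Cardinal.mk_fin, htr] at hcard
    exact_mod_cast hcard
  /- 7. conclusion -/
  subst hn
  have hu2 : ![u 0, u 1] = u := by
    ext i
    fin_cases i <;> rfl
  have hset₁ : ({u 0, u 1} : Set K) = Set.range u := by
    ext x
    simp only [Set.mem_insert_iff, Set.mem_singleton_iff, Set.mem_range, Fin.exists_fin_two]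
    constructor
    · rintro (rfl | rfl)
      exacts [Or.inl rfl, Or.inr rfl]
    · rintro (h0 | h1)
      exacts [Or.inl h0.symm, Or.inr h1.symm]
  have hset₂ : ({u 0, u 1, η} : Set K) = insert η (Set.range u) := by
    rw [← hset₁]
    ext x
    simp only [Set.mem_insert_iff, Set.mem_singleton_iff]
    tauto
  refine ⟨u 0, u 1, η, h, hu2 ▸ hind, huO 0, huO 1, hηO, fun i => hset₁ ▸ hcoef i, hmon, hroot,
    hder, ?_⟩
  rw [hset₂]
  exact hF

/-- **Registered sub-goal `exists_henselPresentation_of_lipman` (crux `SemivaluationShadows`,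
line `birth`): Lipman's theorem ⇒ the Hensel-over-ruled presentation of a rationally valued
surface.** Let `k` be algebraically closed of characteristic `p`, `K/k` finitely generated of
transcendence degree `2`, `O ⊇ k` a valuation ring of `K` all of whose residues are constants and
whose valuation is non-trivial. ASSUMING the valuative corollary of Lipman's desingularization of
surfaces (`Lipman1978ValuativeQuadraticSequence`), there are `K₀ ≤ K`, `t, v, η ∈ K` and a monic
`h ∈ K[X]` forming the Hensel-over-ruled presentation of `(K, O)` (the predicate of
`exists_henselPresentation_of_coordinates`, verbatim). Proof: affine model `A ⊆ O`
(`exists_affineModel`); a regular stage `B = tower O A m` of the tower of normalised quadratic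
transforms along `O` (`SyzygyFlattening.stub_surfaceCase`, fed with the Lipman fact); étale
coordinates at the regular centre (`exists_etaleCoordinates_of_isRegularLocalRing`); the landed
`exists_henselPresentation_of_coordinates`. (The non-triviality hypothesis is not needed.)
[cite: Lipman1978, Theorem p. 151] -/
theorem exists_henselPresentation_of_lipman : Literature.AlgebraicGeometry.Resolution.Lipman1978ValuativeQuadraticSequence.{0} → ∀ p : ℕ, p.Prime → ∀ (k K : Type) [Field k] [CharP k p] [IsAlgClosed k] [Field K] [Algebra k K], (⊤ : IntermediateField k K).FG → ∀ (O : ValuationSubring K) (hk : ∀ c : k, algebraMap k K c ∈ O), (∀ x : K, x ∈ O → ∃ c : k, O.valuation (x - algebraMap k K c) < 1) → (∃ x : K, x ∈ O ∧ O.valuation x < 1 ∧ x ≠ 0) → Algebra.trdeg k K = 2 → ∃ (K₀ : IntermediateField k K) (t v η : K) (h : Polynomial K), t ∈ K₀ ∧ t ≠ 0 ∧ O.valuation t < 1 ∧ (∀ x : K, x ∈ K₀ → x ≠ 0 → ∃ m : ℤ, O.valuation x = O.valuation t ^ m) ∧ Transcendental K₀ v ∧ (∀ i : ℕ, h.coeff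 i ∈ IntermediateField.adjoin K₀ {v} ∧ h.coeff i ∈ O) ∧ h.Monic ∧ Polynomial.aeval η h = 0 ∧ O.valuation (Polynomial.aeval η (Polynomial.derivative h)) = 1 ∧ η ∈ O ∧ IntermediateField.adjoin K₀ {v, η} = ⊤ := by
  intro hLip p hp k K _ _ _ _ _ hfg O hk hrat _hnt htr
  classical
  -- an affine model `A ⊆ O` of `K`
  obtain ⟨A, hAO, hAfg, hAfrac⟩ := exists_affineModel k K hfg O hk
  -- Lipman: some stage of the tower of normalised quadratic transforms along `O` is regular
  have hn : SyzygyFlattening.syzygyIndex k K = 2 := by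
    unfold SyzygyFlattening.syzygyIndex
    rw [htr]
    simp
  obtain ⟨m, hreg⟩ := SyzygyFlattening.stub_surfaceCase hLip k K O A hk hAfg hAfrac hAO hn
  set B := SyzygyFlattening.tower O A m with hB
  haveI : IsRegularLocalRing B := hreg
  haveI : IsFractionRing B K := SyzygyFlattening.isFractionRing_tower O A hAfrac m
  haveI : Algebra.EssFiniteType k B :=
    SyzygyFlattening.essFiniteType_tower O A hk hAfg hAfrac hAO m
  have hBO : B.toSubring ≤ O.toSubring := SyzygyFlattening.tower_toSubring_le O hk hAO m
  have hfrac : ∀ z : K, ∃ a b : B, z = B.val a / B.val b := fun z => by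
    obtain ⟨a, b, -, hab⟩ := IsFractionRing.div_surjective (A := B) z
    exact ⟨a, b, hab.symm⟩
  -- étale coordinates at the regular centre, then the Hensel presentation
  obtain ⟨u₀, u₁, η, h, hind, hu₀, hu₁, hη, hcoef, hmon, hroot, hder, hgen⟩ :=
    exists_etaleCoordinates_of_isRegularLocalRing O htr B.val Subtype.val_injective
      (fun a => hBO a.2) hfrac
  exact exists_henselPresentation_of_coordinates k K O hk hrat u₀ u₁ η h hind hu₀ hu₁ hη hcoef
    hmon hroot hder hgen

/-! ## The surface bridge assembled with the Hensel-over-ruled stub (secondary registered sub-goal) -/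


/-- **A valuation ring whose value group has rational rank one is non-trivially valued**: if
`finrank_ℤ Γ_O = 1` then some non-zero `x ∈ O` has `ν(x) < 1` (a non-trivial element of the
value group is `ν(x)` for some `x`; replace `x` by `x⁻¹` if `ν(x) > 1`). [folklore] -/
theorem exists_mem_valuation_lt_one_of_finrank_eq_one {K : Type*} [Field K]
    (O : ValuationSubring K) (hr : Module.finrank ℤ (Additive (O.ValueGroup)ˣ) = 1) :
    ∃ x : K, x ∈ O ∧ O.valuation x < 1 ∧ x ≠ 0 := by
  have hnt : Nontrivial (Additive (O.ValueGroup)ˣ) :=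
    Module.nontrivial_of_finrank_pos (R := ℤ) (by omega)
  have hnt' : Nontrivial (O.ValueGroup)ˣ := hnt
  obtain ⟨g, hg⟩ := exists_ne (1 : (O.ValueGroup)ˣ)
  obtain ⟨x, hx⟩ := O.valuation_surjective (g : O.ValueGroup)
  have hx0 : x ≠ 0 := by
    intro h0
    rw [h0, map_zero] at hx
    exact g.ne_zero hx.symm
  have hx1 : O.valuation x ≠ 1 := by
    rw [hx]
    exact fun h1 => hg (Units.val_eq_one.mp h1)
  rcases lt_or_gt_of_ne hx1 with hlt | hgt
  · exact ⟨x, (O.valuation_le_one_iff x).mp hlt.le, hlt, hx0⟩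
  · have hinv : O.valuation x⁻¹ < 1 := by
      rw [map_inv₀]
      exact inv_lt_one_of_one_lt₀ hgt
    exact ⟨x⁻¹, (O.valuation_le_one_iff _).mp hinv.le, hinv, inv_ne_zero hx0⟩

/-- **Registered sub-goal `surfaceShadowsRankOne_of_lipman` (crux `SemivaluationShadows`, line
`birth`): the surface case of the rational-rank-one core of the crux, from Lipman's theorem.**
For `k` algebraically closed of characteristic `p`, `K/k` finitely generated of transcendence
degree `2` and `O ⊇ k` a valuation ring of `K` with constant residues and value group of rational
rank one, ASSUMING `Lipman1978ValuativeQuadraticSequence`, every finitely generated `R ⊆ O` and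
finite `F ⊆ R` admit a shadow exact on `F` (the crux's conclusion `HasShadow O R F`, unfolded
verbatim). Proof: the valuation is non-trivial (`exists_mem_valuation_lt_one_of_finrank_eq_one`),
so `exists_henselPresentation_of_lipman` presents `(K, O)` as Hensel-over-ruled, and the landed
`henselOverRuledShadowsRankOne` (worker W-P) gives the shadow. [cite: Lipman1978, Theorem p. 151] -/
theorem surfaceShadowsRankOne_of_lipman : Literature.AlgebraicGeometry.Resolution.Lipman1978ValuativeQuadraticSequence.{0} → ∀ p : ℕ, p.Prime → ∀ (k K : Type) [Field k] [CharP k p] [IsAlgClosed k] [Field K] [Algebra k K], (⊤ : IntermediateField k K).FG → ∀ (O : ValuationSubring K) (hk : ∀ c : k, algebraMap k K c ∈ O), (∀ x : K, x ∈ O → ∃ c : k, O.valuation (x - algebraMap k K c) < 1) → Module.finrank ℤ (Additive (O.ValueGroup)ˣ) = 1 → Algebra.trdeg k K = 2 → ∀ R : Subalgebra k K, R.FG → R.toSubring ≤ O.toSubring → ∀ F : Finset R, ∃ (R₁ : Subalgebra k K) (hle : R ≤ R₁) (_ : R₁.toSubring ≤ O.toSubring), R₁.FG ∧ IsFractionRing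 R₁ K ∧ ∃ (L : Type) (_ : Field L) (_ : Algebra k L) (φ : R₁ →ₐ[k] L) (O' : ValuationSubring L), Module.finrank ℤ (Additive (O'.ValueGroup)ˣ) = Module.finrank ℤ (Additive (O.ValueGroup)ˣ) ∧ (∀ y : R₁, φ y ∈ O') ∧ (∀ y : R₁, O'.valuation (φ y) < 1 ↔ O.valuation (y : K) < 1) ∧ (∀ z : L, z ∈ O' → ∃ c : k, O'.valuation (z - algebraMap k L c) < 1) ∧ (MonoidHom.mrange (O'.valuation.toMonoidWithZeroHom.toMonoidHom.comp φ.toRingHom.toMonoidHom)).FG ∧ ∃ ι : O'.ValueGroup →*₀o O.ValueGroup, Function.Injective ι ∧ (∀ y : R₁, φ y ≠ 0 → ∃ y' : R₁, ι (O'.valuation (φ y)) = O.valuation (y' : K)) ∧ ∀ x ∈ F, ι (O'.valuation (φ (Subalgebra.inclusion hle x))) = O.valuation ((x : R) : K) := by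
  intro hLip p hp k K _ _ _ _ _ hfg O hk hrat hr htr R hR hRO F
  obtain ⟨K₀, t, v, η, h, htK₀, ht0, ht1, hdisc, hv, hcoef, hmon, hroot, hder, hηO, hgen⟩ :=
    exists_henselPresentation_of_lipman hLip p hp k K hfg O hk hrat
      (exists_mem_valuation_lt_one_of_finrank_eq_one O hr) htr
  exact henselOverRuledShadowsRankOne p hp k K hfg O hk hrat hr K₀ t v η h htK₀ ht0 ht1 hdisc hv
    hcoef hmon hroot hder hηO hgen R hR hRO F

end Summit.ResolutionOfSingularities.ResolutionOfSingularities.Theorems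

end
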